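import Summits.Parity.GeneralizedHardyLittlewood.Theses.LinnikGallagherMV
import Literature.NumberTheory.Sieve.PowTwoExpSumLargeDeviationQual

/-!
# Route `LinnikGallagherMV` — crux `GallagherLargeDeviationQual` (stmt-Parity-20513)

Gallagher's large-deviation lemma for `G_L(α) = Σ_(ν<L) e(2^ν α)` in qualitative form — for every
`c < 1` there are `λ < 1` and `L₀` with `|{α ∈ [0,1] : |G_L(α)| ≥ λL}| ≤ 2^(−cL)` for `L ≥ L₀` — is
VERBATIM the tree theorem `Literature.NumberTheory.Sieve.PintzRuzsa2003.gallagherLargeDeviationQual`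
(`Literature/NumberTheory/Sieve/PowTwoExpSumLargeDeviationQual.lean`, p532468); this file closes the
item by `exact`.  Honesty label of the route: a FORMALISATION floor rung (F-LGE) of Parity —
formalisation-first of Linnik 1953 / Gallagher 1975; no new mathematics, no value of `K`, never
distance-to-Goldbach.

References: P. X. Gallagher, Invent. Math. 29 (1975), Lemma 1 [Gallagher1975]; D. R. Heath-Brown,
J.-C. Puchta, Asian J. Math. 6 (2002), Lemma 1 [HeathbrownPuchta2002]; J. Pintz, I. Z. Ruzsa,
Acta Arith. 109 (2003), Theorem 3 [PintzRuzsa2003].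
-/

namespace Summit.Parity.GeneralizedHardyLittlewood.Theorems

/-- **Crux `GallagherLargeDeviationQual` PROVED** (item stmt-Parity-20513): for every `c < 1` there
are `λ < 1` and `L₀` such that `|{α ∈ [0,1] : λL ≤ |G_L(α)|}| ≤ 2^(−cL)` for all `L ≥ L₀`,
`G_L = GoldbachLinnik.powSumL L` — by the Literature theorem
`PintzRuzsa2003.gallagherLargeDeviationQual` (Gallagher 1975 Lemma 1 in the `c`-form, via the moment
bound for binary digit changes and the tree's Chernoff frame). [cite: Gallagher1975, Lemma 1] -/
theorem linnikGallagherMV_gallagherLargeDeviationQual_proof :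
    Summit.Parity.GeneralizedHardyLittlewood.Theses.LinnikGallagherMV.GallagherLargeDeviationQual :=
  Literature.NumberTheory.Sieve.PintzRuzsa2003.gallagherLargeDeviationQual

end Summit.Parity.GeneralizedHardyLittlewood.Theorems
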